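import Mathlib
import HarnessLib
import Summits.Langlands.Langlands.Theses.EvenArtinGL4Door

/-!
# Birth skeleton (BC3) for crux stmt-Langlands-2906
`Summit.Langlands.Langlands.Theses.EvenArtinGL4Door.RealQuadraticDoorDescent` — line `birth`

Route `route-Langlands-EvenArtinGL4Door` (crux C3, rank 4, "multi-door descent"; the route's own
two-layer plan names this cut: `RealQuadraticDoorDescent ⇐ SingleDoorUpToSigns → MultiDoorRigidity`).

The crux: `ρ : Γ_ℚ → GL₂(ℂ)` irreducible of icosahedral type; IF for EVERY real quadratic `L` with
`2 ∤ disc L` there are door data `(ψ, R)` — `ψ : Γ_L → ℂˣ` of finite order and MIXED signature with no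
`ψ^(2^a)` descending to `ℚ`, `R ≅ Ind_L^ℚ(ρ|_L ⊗ ψ)` framed — and a cuspidal `Π` on `GL₄(𝔸_ℚ)` with
Satake(Π) = Frobenius(R) at almost all places, THEN some cuspidal `π` on `GL₂(𝔸_ℚ)` has
Satake(π) = Frobenius(ρ) at almost all places (strong Artin for `ρ` in Tunnell's a.e. sense).

The two stubs (stages 1+2 and stage 3 of the filed sketch):

* `stub_singleDoor` — **ONE door descends to `GL₂/ℚ` up to a common, door-pinned sign.** For ONE
  admissible `L` with door data `(ψ, R)` and a matching cuspidal `Π` on `GL₄(𝔸_ℚ)`: there is a cuspidal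
  `π = π^(L)` on `GL₂(𝔸_ℚ)` with `Sat(π_v) = ε_v · {eigenvalues of ρ(Frob_v)}`, `ε_v = ±1`, at almost all
  `v`, and `ε_v = +1` at every such `v` where the Frobenius characteristic polynomial of `R` is NOT
  even (not invariant under `X ↦ -X`). Mechanism: `Π ≅ Π ⊗ χ_L` (strong multiplicity one) ⇒
  `Π = AI_L^ℚ(Π_L)` (Arthur–Clozel Ch. 3 Thm 4.2 (b)); Rankin–Selberg pole calculus for
  `BC_L(Π) × (BC_L(Π) ⊗ ψ^(1-τ))^∨` (Jacquet–Shalika, Shahidi) against the Galois side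
  `ord_(s=1) L(s, Artin) = -mult(𝟙)` (needs `ψ²` not from `ℚ`) ⇒ exactly one of `Π_L ψ⁻¹`, `Π_L^τ ψ⁻¹`
  is `τ`-invariant ⇒ it is `BC_L(π^(L))` with `π^(L)` cuspidal on `GL₂(𝔸_ℚ)` (AC Thm 4.2 (d); `ρ|_L` stays
  icosahedral). Local bookkeeping at a split `p = w w^τ`: `S ∪ ξ_w S = {a,b} ∪ ξ_w {a,b}` with
  `S = Sat(π^(L)_p)`, `{a,b}` the eigenvalues of `ρ(Frob_p)`, `ξ = ψ^(τ-1)`; this forces `S = {a,b}` unless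
  `ξ_w = -1` (sign-flip ambiguity `S ∈ {±a} × {±b}`) or `a + b = 0`; at inert `p` the charpoly of
  `R(Frob_p)` is a polynomial in `X²` (induced from the index-2 subgroup `Γ_L`) and only `{α², β²} = {a², b²}`
  is learned. The central character is pinned by Rankin–Selberg for `Sym² π^(L)` on `GL₃` against Chebotarev
  for `ρ` (an impostor quadratic `η = ω_π / det ρ ≠ 1` would give prime-average `|a² + b² + η ab|² = 3`, not
  the mandatory `1`), so all sign defects are COMMON (`ε₁ = ε₂`), which also removes the fourth-root-of-unity
  ambiguity at trace-zero primes. Evenness of `charpoly R(Frob_v)` is exactly "`v` inert, or `v` split with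
  `ξ_w = -1`, or `tr ρ(Frob_v) = 0`" — stated through `R` alone so that no `ψ`-Frobenius vocabulary is
  needed. Size: L (every step is a printed theorem; the composite is not in print). Implied by strong Artin
  for `ρ` (take `π = π(ρ)`, `ε ≡ 1`), hence irrefutable short of refuting Langlands (B) for `ρ`.
* `stub_multiDoorRigidity` — **sign rigidity across all doors.** If for EVERY admissible `L` there are door
  data `(ψ, R)` and a cuspidal `π^(L)` on `GL₂(𝔸_ℚ)` matching `ρ` up to a common door-pinned sign as above,
  then some cuspidal `π` matches `ρ` EXACTLY a.e. Mechanism (the filed sketch, stage 3): `ad(π^(L)) ↔ ad⁰ρ`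
  exactly for every `L` (common signs) ⇒ all `π^(L)` are quadratic twists of one `π₀` (Gelbart–Jacquet +
  SMO on `GL₃` + Ramakrishnan's multiplicity one for `SL(2)`, Ann. Math. 152 Thm 4.1.2 — the one named fact
  the grounder flagged as NOT yet in tree); the sign defect of `π₀` is `+1` at the `R_L`-asymmetric primes of
  every door, and every pair of primes is simultaneously controlled by some admissible `L` (`d ≡ 5 mod 8`
  with prescribed Legendre symbols: CRT + Dirichlet); Chebotarev in `M · L(ψ)` excludes the value `-1` on
  `{p : tr ρ(Frob_p) ≠ 0}`. THIS is where the crux's own "why it might fail" lives (forcing ONE global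
  quadratic character). No `GL₄` object occurs in this stub. Implied by strong Artin for `ρ`; irrefutable
  likewise. Size: L.
* `RealQuadraticDoorDescent_of` — **the composition, kernel-checked (pure logic):** the crux hypothesis hands
  a door `(ψ, R, Π)` for every admissible `L`; `stub_singleDoor` turns each into `(ψ, R, π^(L))`;
  `stub_multiDoorRigidity` concludes. Concludes the route decl BY NAME.

Honest reading of the cut: the GL₄ → GL₂ functoriality (AI-fibres, cyclic descent, Rankin–Selberg poles,
central character) is isolated in `stub_singleDoor`, whose conclusion records exactly what ONE door
provably pins (common sign, `+1` off the even-charpoly locus of `R`) and nothing more; the genuinely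
uncertain multi-door Chebotarev bookkeeping is `stub_multiDoorRigidity`, a statement about `GL₂/ℚ` cusp
forms and an icosahedral `ρ` only. Neither stub gives the crux on its own (stub 1 has no rigidity, stub 2
has no way to produce the `π^(L)`), and neither mentions `_root_.Langlands`.

Disproof used: none on file for this crux (`ledger crux ls stmt-Langlands-2906`: no `Disproof.lean`, no
`Negative/` lemmas; `ledger negatives --problem Langlands`: 3 entries, none about this route; 2026-08-17).
Negatives-index lesson honoured: ranks are fixed (`2`, `4`), `ρ` irreducible — no `n = 0` degeneration of
the `OrdinaryPrimeTransport.RankinSelbergPoleCount` kind.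

Shape (for `ledger skeleton check` / `#h21_check_skeleton`): stubs `theorem stub_<name> : <signature> := by
sorry` stated over tree declarations only (the route's own cone: `FramedGaloisRep`, `IsComplexConjugation`,
`absGaloisRestrict`, `Representation.ind`, `isCompact_glFiniteIntegralLevel`, `CuspidalAutomorphicRepData`,
`HasSatakeParamAt`, `satakePolynomial`, Mathlib); `_Goal.stub_<name> : Prop := type_of% @stub_<name>` names
each statement; the composition `RealQuadraticDoorDescent_of (h₁ : _Goal.stub_singleDoor)
(h₂ : _Goal.stub_multiDoorRigidity) : RealQuadraticDoorDescent` is proved without `sorry`.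
-/

set_option linter.dupNamespace false
set_option linter.unusedVariables false

noncomputable section

namespace Summit.Langlands.Langlands.Cruxes.RealQuadraticDoorDescent.Birth

open Summit.Langlands.Langlands.Theses.EvenArtinGL4Door
open Literature.NumberTheory.Automorphic Literature.NumberTheory.GaloisRepresentations
open NumberField IsDedekindDomain Filter
open scoped Polynomial

/-! ## 0. Vocabulary (readable names for the crux's verbatim clauses; all comparisons below are `Iff.rfl`) -/

/-- `ρ` is of icosahedral type: projective image `≃ A₅` (the crux's clause, verbatim). [folklore] -/
def IsIcosahedral (ρ : FramedGaloisRep ℚ ℂ 2) : Prop :=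
  Nonempty ((Matrix.ProjGenLinGroup.mk.comp ρ.toMonoidHom).range ≃* alternatingGroup (Fin 5))

/-- **Door data** for `ρ` over `L` (the crux's conjunct, verbatim): `ψ` has mixed signature, no `ψ^(2^a)`
is the restriction of a character of `Γ_ℚ`, and `R` is a framed model of `Ind_L^ℚ(ρ|_L ⊗ ψ)`. [folklore] -/
def DoorData (ρ : FramedGaloisRep ℚ ℂ 2) (L : Type) [Field L] [NumberField L]
    (ψ : FramedGaloisRep L ℂ 1) (R : FramedGaloisRep ℚ ℂ 4) : Prop :=
  (∃ (φ₁ φ₂ : L →+* ℝ) (c₁ c₂ : Field.absoluteGaloisGroup L),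
      IsComplexConjugation φ₁ c₁ ∧ IsComplexConjugation φ₂ c₂ ∧ ψ c₁ ≠ ψ c₂) ∧
  (∀ (a : ℕ) (χ : FramedGaloisRep ℚ ℂ 1), ∃ g : Field.absoluteGaloisGroup L,
      (ψ g) ^ (2 ^ a) ≠ χ (absGaloisRestrict ℚ L g)) ∧
  (∃ σ : FramedGaloisRep L ℂ 2,
      (∀ g : Field.absoluteGaloisGroup L,
        ((σ g : Matrix.GeneralLinearGroup (Fin 2) ℂ) : Matrix (Fin 2) (Fin 2) ℂ) =
          ((ψ g : Matrix.GeneralLinearGroup (Fin 1) ℂ) : Matrix (Fin 1) (Fin 1) ℂ) 0 0 •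
            ((FramedGaloisRep.restrictField L ρ g : Matrix.GeneralLinearGroup (Fin 2) ℂ) :
              Matrix (Fin 2) (Fin 2) ℂ)) ∧
      Nonempty (R.toGaloisRep.toRepresentation.Equiv
        (Representation.ind (absGaloisRestrict ℚ L).toMonoidHom σ.toGaloisRep.toRepresentation)))

/-- **Exact a.e. matching** for `GL_n/ℚ` (the crux's `IsPiOfArtinRep` clause, verbatim): Satake parameter of
`π` at `v` = roots of the Frobenius characteristic polynomial of `r` at `v`, at all but finitely many `v`.
[folklore] -/
def MatchesAE {n : ℕ} (r : FramedGaloisRep ℚ ℂ n) {hcpt : isCompact_glFiniteIntegralLevel n ℚ}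
    (π : CuspidalAutomorphicRepData n ℚ hcpt) : Prop :=
  ∀ᶠ v : HeightOneSpectrum (𝓞 ℚ) in cofinite, ∃ α : Multiset ℂ,
    π.1.HasSatakeParamAt v α ∧ r.IsUnramifiedAt v ∧ r.HasFrobCharpolyAt v (satakePolynomial α)

/-- **Matching up to a common, door-pinned sign**: at almost all `v`, `Sat(π_v) = α` and the Frobenius
characteristic polynomial of `ρ` at `v` is that of `ε_v • α` with `ε_v ^ 2 = 1` (one sign for both
eigenvalues: central character already pinned), and `ε_v = 1` whenever the Frobenius characteristic
polynomial `P` of the door representation `R` at `v` is NOT even (`P(-X) ≠ P(X)`; for `R = Ind_L^ℚ(ρ|_L ⊗ ψ)`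
this says: `v` split in `L`, `ψ^(τ-1)(Frob_w) ≠ -1`, `tr ρ(Frob_v) ≠ 0`). [folklore] -/
def MatchesUpToDoorSign (ρ : FramedGaloisRep ℚ ℂ 2) (R : FramedGaloisRep ℚ ℂ 4)
    {hcpt : isCompact_glFiniteIntegralLevel 2 ℚ} (π : CuspidalAutomorphicRepData 2 ℚ hcpt) : Prop :=
  ∀ᶠ v : HeightOneSpectrum (𝓞 ℚ) in cofinite, ∃ (α : Multiset ℂ) (ε : ℂ),
    ε ^ 2 = 1 ∧ π.1.HasSatakeParamAt v α ∧ ρ.IsUnramifiedAt v ∧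
      ρ.HasFrobCharpolyAt v (satakePolynomial (α.map (ε * ·))) ∧
      ((∃ P : ℂ[X], R.IsUnramifiedAt v ∧ R.HasFrobCharpolyAt v P ∧ P.comp (-Polynomial.X) ≠ P) → ε = 1)

/-- The crux unfolded over the vocabulary (definitional). [folklore] -/
theorem realQuadraticDoorDescent_iff :
    RealQuadraticDoorDescent ↔
      ∀ ρ : FramedGaloisRep ℚ ℂ 2, ρ.toGaloisRep.IsIrreducible → IsIcosahedral ρ →
        (∀ (L : Type) [Field L] [NumberField L], Module.finrank ℚ L = 2 → IsTotallyReal L →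
          ¬ (2 : ℤ) ∣ discr L →
            ∃ (ψ : FramedGaloisRep L ℂ 1) (R : FramedGaloisRep ℚ ℂ 4), DoorData ρ L ψ R ∧
              ∃ (hcpt : isCompact_glFiniteIntegralLevel 4 ℚ) (π₄ : CuspidalAutomorphicRepData 4 ℚ hcpt),
                MatchesAE R π₄) →
        ∃ (hcpt : isCompact_glFiniteIntegralLevel 2 ℚ) (π : CuspidalAutomorphicRepData 2 ℚ hcpt),
          MatchesAE ρ π :=
  Iff.rfl

/-! ## 1. The two stubs -/

/-- **STUB 1 — one door descends to `GL₂/ℚ` up to a common, door-pinned sign** (stages 1–2 of the filed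
sketch). For `ρ` irreducible icosahedral, ONE admissible `L` (real quadratic, `2 ∤ disc L`), door data
`(ψ, R)` and a cuspidal `Π` on `GL₄(𝔸_ℚ)` with Satake(Π) = Frobenius(R) a.e.: there is a cuspidal `π` on
`GL₂(𝔸_ℚ)` matching `ρ` a.e. up to a common sign `ε_v`, with `ε_v = 1` off the even-charpoly locus of `R`.
`Π ≅ Π ⊗ χ_L` (SMO) ⇒ `Π = AI(Π_L)` (Arthur–Clozel Ch. 3 Thm 4.2 (b), tree facts
`ArthurClozel1989_inducedLift_of_twist_eq`, `automorphicInduction_cyclic`); Rankin–Selberg poles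
(Jacquet–Shalika 1981; Shahidi) vs `ord_(s=1)` of Artin `L`-functions (Brauer–Hecke; needs `ψ²` not from `ℚ`)
⇒ exactly one of `Π_L ψ⁻¹`, `Π_L^τ ψ⁻¹` is `τ`-invariant ⇒ `= BC_L(π)` (AC Thm 4.2 (d),
`ArthurClozel1989_cuspidal_descent`, `_fibres_of_baseChange`); local bookkeeping `S ∪ ξ_w S = {a,b} ∪ ξ_w{a,b}`
at split places; central character `ω_π = det ρ` by Rankin–Selberg for `Sym² π` (Gelbart–Jacquet) against
Chebotarev for `ρ` (tree: `ChebotarevArtinRep*`). Size: L. Implied by strong Artin for `ρ`.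
[cite: ArthurClozelAMS120, Ch. 3 Thm 4.2 (b),(d)] [cite: JacquetShalikaAJM1981, Thm 4.7]
[cite: GelbartJacquet1978, Thm 9.3] [cite: Ramakrishnan2000, Thm M] -/
theorem stub_singleDoor :
    ∀ ρ : FramedGaloisRep ℚ ℂ 2, ρ.toGaloisRep.IsIrreducible →
      Nonempty ((Matrix.ProjGenLinGroup.mk.comp ρ.toMonoidHom).range ≃* alternatingGroup (Fin 5)) →
      ∀ (L : Type) [Field L] [NumberField L], Module.finrank ℚ L = 2 → IsTotallyReal L →
        ¬ (2 : ℤ) ∣ discr L →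
        ∀ (ψ : FramedGaloisRep L ℂ 1) (R : FramedGaloisRep ℚ ℂ 4),
          ((∃ (φ₁ φ₂ : L →+* ℝ) (c₁ c₂ : Field.absoluteGaloisGroup L),
              IsComplexConjugation φ₁ c₁ ∧ IsComplexConjugation φ₂ c₂ ∧ ψ c₁ ≠ ψ c₂) ∧
            (∀ (a : ℕ) (χ : FramedGaloisRep ℚ ℂ 1), ∃ g : Field.absoluteGaloisGroup L,
              (ψ g) ^ (2 ^ a) ≠ χ (absGaloisRestrict ℚ L g)) ∧
            (∃ σ : FramedGaloisRep L ℂ 2,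
              (∀ g : Field.absoluteGaloisGroup L,
                ((σ g : Matrix.GeneralLinearGroup (Fin 2) ℂ) : Matrix (Fin 2) (Fin 2) ℂ) =
                  ((ψ g : Matrix.GeneralLinearGroup (Fin 1) ℂ) : Matrix (Fin 1) (Fin 1) ℂ) 0 0 •
                    ((FramedGaloisRep.restrictField L ρ g : Matrix.GeneralLinearGroup (Fin 2) ℂ) :
                      Matrix (Fin 2) (Fin 2) ℂ)) ∧
              Nonempty (R.toGaloisRep.toRepresentation.Equiv
                (Representation.ind (absGaloisRestrict ℚ L).toMonoidHom
                  σ.toGaloisRep.toRepresentation)))) →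
          ∀ (hcpt : isCompact_glFiniteIntegralLevel 4 ℚ) (π₄ : CuspidalAutomorphicRepData 4 ℚ hcpt),
            (∀ᶠ v : HeightOneSpectrum (𝓞 ℚ) in cofinite, ∃ α : Multiset ℂ,
              π₄.1.HasSatakeParamAt v α ∧ R.IsUnramifiedAt v ∧
                R.HasFrobCharpolyAt v (satakePolynomial α)) →
            ∃ (hcpt₂ : isCompact_glFiniteIntegralLevel 2 ℚ) (π : CuspidalAutomorphicRepData 2 ℚ hcpt₂),
              ∀ᶠ v : HeightOneSpectrum (𝓞 ℚ) in cofinite, ∃ (α : Multiset ℂ) (ε : ℂ),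
                ε ^ 2 = 1 ∧ π.1.HasSatakeParamAt v α ∧ ρ.IsUnramifiedAt v ∧
                  ρ.HasFrobCharpolyAt v (satakePolynomial (α.map (ε * ·))) ∧
                  ((∃ P : ℂ[X], R.IsUnramifiedAt v ∧ R.HasFrobCharpolyAt v P ∧
                      P.comp (-Polynomial.X) ≠ P) → ε = 1) := by
  sorry

/-- **STUB 2 — sign rigidity across all doors** (stage 3 of the filed sketch; the crux's own "why it might
fail" lives here). For `ρ` irreducible icosahedral: if for EVERY admissible `L` there are door data `(ψ, R)`
and a cuspidal `π^(L)` on `GL₂(𝔸_ℚ)` matching `ρ` a.e. up to a common sign that is `+1` off the even-charpoly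
locus of `R`, then some cuspidal `π` on `GL₂(𝔸_ℚ)` matches `ρ` EXACTLY a.e. Mechanism: `ad(π^(L)) ↔ ad⁰ρ`
exactly for all `L` ⇒ the `π^(L)` are quadratic twists of one `π₀` (Gelbart–Jacquet, SMO on `GL₃`,
Ramakrishnan's multiplicity one for `SL(2)` — Ann. Math. 152 (2000) Thm 4.1.2, named fact WANTED, not yet
in tree); the sign defect of `π₀` is `+1` at the `R_L`-asymmetric primes of every door (= split in `L`,
`ψ_L^(τ-1)(Frob_w) ≠ -1`, `tr ρ ≠ 0`); any two primes are simultaneously controlled by some admissible `L`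
(`d ≡ 5 (8)`, prescribed Legendre symbols); Chebotarev in `M·L(ψ)` excludes `-1`. No `GL₄` object occurs.
Size: L (not in print). Implied by strong Artin for `ρ`.
[cite: Ramakrishnan2000, Thm 4.1.2] [cite: GelbartJacquet1978, Thm 9.3] [cite: JacquetShalikaAJM1981, Thm 4.7] -/
theorem stub_multiDoorRigidity :
    ∀ ρ : FramedGaloisRep ℚ ℂ 2, ρ.toGaloisRep.IsIrreducible →
      Nonempty ((Matrix.ProjGenLinGroup.mk.comp ρ.toMonoidHom).range ≃* alternatingGroup (Fin 5)) →
      (∀ (L : Type) [Field L] [NumberField L], Module.finrank ℚ L = 2 → IsTotallyReal L →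
        ¬ (2 : ℤ) ∣ discr L →
        ∃ (ψ : FramedGaloisRep L ℂ 1) (R : FramedGaloisRep ℚ ℂ 4),
          ((∃ (φ₁ φ₂ : L →+* ℝ) (c₁ c₂ : Field.absoluteGaloisGroup L),
              IsComplexConjugation φ₁ c₁ ∧ IsComplexConjugation φ₂ c₂ ∧ ψ c₁ ≠ ψ c₂) ∧
            (∀ (a : ℕ) (χ : FramedGaloisRep ℚ ℂ 1), ∃ g : Field.absoluteGaloisGroup L,
              (ψ g) ^ (2 ^ a) ≠ χ (absGaloisRestrict ℚ L g)) ∧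
            (∃ σ : FramedGaloisRep L ℂ 2,
              (∀ g : Field.absoluteGaloisGroup L,
                ((σ g : Matrix.GeneralLinearGroup (Fin 2) ℂ) : Matrix (Fin 2) (Fin 2) ℂ) =
                  ((ψ g : Matrix.GeneralLinearGroup (Fin 1) ℂ) : Matrix (Fin 1) (Fin 1) ℂ) 0 0 •
                    ((FramedGaloisRep.restrictField L ρ g : Matrix.GeneralLinearGroup (Fin 2) ℂ) :
                      Matrix (Fin 2) (Fin 2) ℂ)) ∧
              Nonempty (R.toGaloisRep.toRepresentation.Equiv
                (Representation.ind (absGaloisRestrict ℚ L).toMonoidHom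
                  σ.toGaloisRep.toRepresentation)))) ∧
          ∃ (hcpt₂ : isCompact_glFiniteIntegralLevel 2 ℚ) (π : CuspidalAutomorphicRepData 2 ℚ hcpt₂),
            ∀ᶠ v : HeightOneSpectrum (𝓞 ℚ) in cofinite, ∃ (α : Multiset ℂ) (ε : ℂ),
              ε ^ 2 = 1 ∧ π.1.HasSatakeParamAt v α ∧ ρ.IsUnramifiedAt v ∧
                ρ.HasFrobCharpolyAt v (satakePolynomial (α.map (ε * ·))) ∧
                ((∃ P : ℂ[X], R.IsUnramifiedAt v ∧ R.HasFrobCharpolyAt v P ∧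
                    P.comp (-Polynomial.X) ≠ P) → ε = 1)) →
      ∃ (hcpt : isCompact_glFiniteIntegralLevel 2 ℚ) (π : CuspidalAutomorphicRepData 2 ℚ hcpt),
        ∀ᶠ v : HeightOneSpectrum (𝓞 ℚ) in cofinite, ∃ α : Multiset ℂ,
          π.1.HasSatakeParamAt v α ∧ ρ.IsUnramifiedAt v ∧ ρ.HasFrobCharpolyAt v (satakePolynomial α) := by
  sorry

/-! ## 2. The stub statements as named `Prop`s (literally their types) -/

namespace _Goal

/-- The statement of `stub_singleDoor`, as a named `Prop` (literally its type). [folklore] -/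
def stub_singleDoor : Prop :=
  type_of% @Summit.Langlands.Langlands.Cruxes.RealQuadraticDoorDescent.Birth.stub_singleDoor

/-- The statement of `stub_multiDoorRigidity`, as a named `Prop` (literally its type). [folklore] -/
def stub_multiDoorRigidity : Prop :=
  type_of% @Summit.Langlands.Langlands.Cruxes.RealQuadraticDoorDescent.Birth.stub_multiDoorRigidity

end _Goal

/-- The two named statements over this file's vocabulary (definitional). [folklore] -/
theorem goals_iff :
    (_Goal.stub_singleDoor ↔
      ∀ ρ : FramedGaloisRep ℚ ℂ 2, ρ.toGaloisRep.IsIrreducible → IsIcosahedral ρ →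
        ∀ (L : Type) [Field L] [NumberField L], Module.finrank ℚ L = 2 → IsTotallyReal L →
          ¬ (2 : ℤ) ∣ discr L → ∀ (ψ : FramedGaloisRep L ℂ 1) (R : FramedGaloisRep ℚ ℂ 4), DoorData ρ L ψ R →
            ∀ (hcpt : isCompact_glFiniteIntegralLevel 4 ℚ) (π₄ : CuspidalAutomorphicRepData 4 ℚ hcpt),
              MatchesAE R π₄ →
              ∃ (hcpt₂ : isCompact_glFiniteIntegralLevel 2 ℚ) (π : CuspidalAutomorphicRepData 2 ℚ hcpt₂),
                MatchesUpToDoorSign ρ R π) ∧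
    (_Goal.stub_multiDoorRigidity ↔
      ∀ ρ : FramedGaloisRep ℚ ℂ 2, ρ.toGaloisRep.IsIrreducible → IsIcosahedral ρ →
        (∀ (L : Type) [Field L] [NumberField L], Module.finrank ℚ L = 2 → IsTotallyReal L →
          ¬ (2 : ℤ) ∣ discr L → ∃ (ψ : FramedGaloisRep L ℂ 1) (R : FramedGaloisRep ℚ ℂ 4), DoorData ρ L ψ R ∧
            ∃ (hcpt₂ : isCompact_glFiniteIntegralLevel 2 ℚ) (π : CuspidalAutomorphicRepData 2 ℚ hcpt₂),
              MatchesUpToDoorSign ρ R π) →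
        ∃ (hcpt : isCompact_glFiniteIntegralLevel 2 ℚ) (π : CuspidalAutomorphicRepData 2 ℚ hcpt),
          MatchesAE ρ π) :=
  ⟨Iff.rfl, Iff.rfl⟩

/-! ## 3. The composition (kernel-checked, no `sorry`): one door per `L` → rigidity → the crux by name -/

/-- **`RealQuadraticDoorDescent` from the two stubs.** Given `ρ` irreducible icosahedral and the crux's
hypothesis (a door `(ψ, R, Π)` for every admissible `L`): `stub_singleDoor` descends each door to a cuspidal
`π^(L)` on `GL₂(𝔸_ℚ)` matching `ρ` up to a common door-pinned sign; `stub_multiDoorRigidity` turns the family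
`(ψ_L, R_L, π^(L))_L` into one `π` matching `ρ` exactly a.e. The hypotheses are, by name, the statements of
the two stubs; the conclusion is the route decl
`Summit.Langlands.Langlands.Theses.EvenArtinGL4Door.RealQuadraticDoorDescent`. [folklore] -/
theorem RealQuadraticDoorDescent_of (h₁ : _Goal.stub_singleDoor) (h₂ : _Goal.stub_multiDoorRigidity) :
    Summit.Langlands.Langlands.Theses.EvenArtinGL4Door.RealQuadraticDoorDescent := by
  -- the stub statements, as the Π-types they literally are
  have hDoor : type_of% @stub_singleDoor := h₁
  have hRigid : type_of% @stub_multiDoorRigidity := h₂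
  intro ρ hirr hico hdoors
  refine hRigid ρ hirr hico ?_
  intro L _ _ hdeg hreal hdisc
  -- the crux hypothesis: a door (ψ, R) with a matching cuspidal Π on GL₄(𝔸_ℚ) for this L
  obtain ⟨ψ, R, hdoor, hcpt, π₄, hπ₄⟩ := hdoors L hdeg hreal hdisc
  -- one door descends to GL₂/ℚ up to a common, door-pinned sign
  obtain ⟨hcpt₂, π, hπ⟩ := hDoor ρ hirr hico L hdeg hreal hdisc ψ R hdoor hcpt π₄ hπ₄
  exact ⟨ψ, R, hdoor, hcpt₂, π, hπ⟩

/-- By-name sanity check (an `example`, not a declaration of the file): the two stubs feed the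
composition as they stand. -/
example : Summit.Langlands.Langlands.Theses.EvenArtinGL4Door.RealQuadraticDoorDescent :=
  RealQuadraticDoorDescent_of stub_singleDoor stub_multiDoorRigidity

end Summit.Langlands.Langlands.Cruxes.RealQuadraticDoorDescent.Birth

end
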